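import Literature.NumberTheory.LFunctions.HeckeThetaInversionComplexWeight
import Literature.NumberTheory.LFunctions.HeckeThetaContinuation
import Mathlib.Analysis.SpecialFunctions.Gaussian.GaussianIntegral
import HarnessLib

/-!
# The Mellin transform of Hecke's theta function with a harmonic weight over an IMAGINARY QUADRATIC field:
# the strong FE-pair of weight `m + 1` and the unfolded Dirichlet series

Topic `Literature/NumberTheory/LFunctions`; namespace `Literature.NumberTheory.LFunctions.NumberField`
(continuing `HeckeThetaInversionComplexWeight.lean`; the sign-weight analogue for a general number field is the chain
`HeckeThetaBounds` → `HeckeThetaMellin` → `HeckeThetaDirichlet` → `HeckeThetaContinuation`).  Third analytic input of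
Hecke's functional equation for the `L`-series of a Größencharakter of infinity type `(m, 0)`, `m ≥ 1`, of an imaginary
quadratic field `K` (Hecke 1920; de Shalit 1987 II.1.1 (1)–(3); Neukirch, *Algebraic Number Theory*, VII §8
(8.3)–(8.5), for Größencharaktere, read in the coset language of VII §8 Remark 1).

For an imaginary quadratic `K` the group `R_+^*` of Neukirch VII §3 is ONE copy of `ℝ_+^*` (`y = t·𝟙` for the unique,
complex, place `w`), the unit group is finite, and no norm-one integral appears: the theta functions of
`HeckeThetaInversionComplexWeight.lean` restricted to the diagonal,

* `f(t) = Θ^{(m)}_{𝔞,a₀}(t) = Σ_{a ∈ 𝔞} σ(a+a₀)^m e^{-2πt|σ(a+a₀)|²}`,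
  `g(t) = Θ̂^{(m)}_{(𝔞𝔡)⁻¹,a₀}(t) = Σ_{b ∈ (𝔞𝔡)⁻¹} e^{2πi Tr(a₀b)} conj(σ b)^m e^{-2πt|σ b|²}` (`σ = σ_w`),

form — for `m ≥ 1`, when the terms at `a + a₀ = 0`, `b = 0` VANISH — a STRONG FE-pair in Mathlib's sense
(`Mathlib.NumberTheory.LSeries.AbstractFuncEq`): `f(1/t) = ε t^{m+1} g(t)` with `ε = (-i)^m (𝔑(𝔞)√|d_K|)⁻¹`
(the transformation formula `heckeThetaC_eq_heckeThetaDualC` at `y = t⁻¹𝟙`, `N(y)^{1/2} = t⁻¹`), both decaying faster than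
any power at `∞` (`heckeThetaPairC`, `isStrongFEPair_heckeThetaPairC`).  Hence (Mathlib) `Λ(s) = ∫₀^∞ f(t) t^s dt/t` is
ENTIRE and `Λ(m + 1 - s) = ε Λ̂(s)`; and we PROVE the unfolding (Neukirch VII (8.3): "`Γ(s)`-integral term by term") on
the half-plane of absolute convergence `re s > m/2 + 1`:

  `Λ(s) = (2π)^{-s} Γ(s) Σ_{x ∈ a₀ + 𝔞, x ≠ 0} σ(x)^m |N_{K/ℚ}(x)|^{-s}`        (`heckeThetaPairC_Λ_eq`),
  `Λ̂(s) = (2π)^{-s} Γ(s) Σ_{b ∈ (𝔞𝔡)⁻¹, b ≠ 0} e^{2πi Tr(a₀ b)} conj(σ b)^m |N_{K/ℚ}(b)|^{-s}`   (`heckeThetaPairC_symm_Λ_eq`),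

the sums being indexed by the tree's representative sets `pieceReps K ∅ 1 𝔞 a₀ N` (for an imaginary quadratic field
the unit rank is `0`, the cone-box condition is void and `pieceReps K ∅ 1 𝔞 a₀ N = (a₀ + 𝔞) ∖ {0}` for every `N`,
`mem_pieceReps_iff_of_isComplex_of_finrank_eq_two`), so that the orbit/class bookkeeping of `RayClassOrbitSums.lean`
and `RayClassFunctionalEquation.lean` applies verbatim downstream.

## What is here (all PROVED; no named fact)

* §1 imaginary quadratic bookkeeping: a complex place `w` and `[K:ℚ] = 2` force a unique infinite place
  (private helpers; the tree has the `[IsTotallyComplex K]` form `subsingleton_infinitePlace_of_finrank_eq_two`), `⟨x·t𝟙, x⟩ = 2t|σx|²`, `N(t𝟙) = t²`, `|σ x|² = |N_{K/ℚ}(x)|`,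
  `rank 𝒪_K^× = 0`, and the description of `pieceReps`.
* §2 the Gaussian-versus-power bound `|σx|^m e^{-π⟨x·t𝟙,x⟩} ≤ e^{m²/(4πδ)} e^{-π⟨x·(t/2)𝟙,x⟩}` (`t ≥ δ`), continuity of
  `f`, `g` on `(0, ∞)`, and their decay `O(t^{-k})` at `∞` through the tree's `weightedThetaTail` /
  `exists_weightedThetaTail_le` (`HeckeThetaBounds.lean`, `p = ∅`).
* §3 the strong FE-pair `heckeThetaPairC` (weight `m+1`, `f₀ = g₀ = 0`).
* §4 the termwise `Γ`-integrals and the two unfolding theorems.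

## References

* J. Neukirch, *Algebraic Number Theory*, Grundlehren 322, Springer 1999, Ch. VII §1 (1.4) (Mellin principle), §3
  (3.5)–(3.6), §8 (8.3)–(8.5) and Remark 1. [NeukirchANT1999]
* E. Hecke, *Eine neue Art von Zetafunktionen und ihre Beziehungen zur Verteilung der Primzahlen II*, Math. Z. 6
  (1920), 11–51. [HeckeMathZ1920]
* E. de Shalit, *Iwasawa theory of elliptic curves with complex multiplication*, Academic Press 1987, II §1.1
  (1)–(3). [deShalit1987]
-/

noncomputable section

open MeasureTheory Filter Set Complex NumberField NumberField.InfinitePlace NumberField.mixedEmbedding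
  NumberField.Units Asymptotics
open scoped Real Topology ENNReal NumberField nonZeroDivisors ComplexConjugate FourierTransform

namespace Literature.NumberTheory.LFunctions

namespace NumberField

variable {K : Type*} [Field K] [NumberField K]

open scoped Classical

/-! ## §1. Imaginary quadratic bookkeeping: one complex place -/

section ImagQuad

variable (w : {w : InfinitePlace K // IsComplex w}) (h2 : Module.finrank ℚ K = 2)
include w h2

/-- A number field of degree `2` with a complex place has exactly one infinite place (`r₁ + 2r₂ = 2`, `r₂ ≥ 1`).
[cite: NeukirchANT1999, Ch. I §5, signature `(r₁, r₂)` with `r₁ + 2 r₂ = n`] -/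
private theorem card_infinitePlace_eq_one_of_isComplex : Fintype.card (InfinitePlace K) = 1 := by
  have h := card_add_two_mul_card_eq_rank K
  rw [h2] at h
  have hc : 1 ≤ nrComplexPlaces K := by
    rw [nrComplexPlaces]
    exact Fintype.card_pos_iff.mpr ⟨w⟩
  rw [card_eq_nrRealPlaces_add_nrComplexPlaces]
  omega

/-- A number field of degree `2` with a complex place has a unique infinite place.
[cite: NeukirchANT1999, Ch. I §5, signature `(r₁, r₂)` with `r₁ + 2 r₂ = n`] -/
private theorem subsingleton_infinitePlace_of_isComplex : Subsingleton (InfinitePlace K) :=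
  Fintype.card_le_one_iff_subsingleton.mp (card_infinitePlace_eq_one_of_isComplex w h2).le

/-- **The unit rank of an imaginary quadratic field is `0`** (`rank 𝒪_K^× = r₁ + r₂ - 1`).
[cite: NeukirchANT1999, Ch. I §7 (7.4) Dirichlet's unit theorem] -/
private theorem units_rank_eq_zero_of_isComplex : rank K = 0 := by
  rw [rank, card_infinitePlace_eq_one_of_isComplex w h2]

/-- On the diagonal `y = t·𝟙`, Neukirch's hermitian form is `⟨x·t𝟙, x⟩ = 2 t |σ_w x|²` (one complex place of weight
`e_w = 2`). [cite: NeukirchANT1999, Ch. VII §3, the form `⟨x, y⟩ = Σ_τ x_τ ȳ_τ` (before (3.1))] -/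
theorem minkowskiQuadForm_const (t : ℝ) (x : K) :
    minkowskiQuadForm K (fun _ ↦ t) x = 2 * t * ‖w.1.embedding x‖ ^ 2 := by
  haveI := subsingleton_infinitePlace_of_isComplex w h2
  rw [minkowskiQuadForm, Fintype.sum_subsingleton _ w.1, mult_isComplex w, norm_embedding_eq]
  norm_num

/-- On the diagonal, `e^{-π⟨x·t𝟙, x⟩} = e^{-2πt|σ_w x|²}`. [cite: NeukirchANT1999, Ch. VII §3 (3.4)] -/
theorem thetaSummand_const (t : ℝ) (x : K) :
    thetaSummand K (fun _ ↦ t) x = Real.exp (-(2 * π * t * ‖w.1.embedding x‖ ^ 2)) := by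
  rw [thetaSummand, minkowskiQuadForm_const w h2]
  ring_nf

/-- On the diagonal, `N(t𝟙) = t²`. [cite: NeukirchANT1999, Ch. VII §3, `N(y) = ∏_τ y_τ`] -/
theorem mixedNorm_const (t : ℝ) : mixedNorm K (fun _ ↦ t) = t ^ 2 := by
  haveI := subsingleton_infinitePlace_of_isComplex w h2
  rw [mixedNorm, Fintype.prod_subsingleton _ w.1, mult_isComplex w]

/-- **`|σ_w x|² = |N_{K/ℚ}(x)|`** for an imaginary quadratic field (the infinite part of the product formula with one
complex place). [cite: NeukirchANT1999, Ch. III §1 (1.3), product formula] -/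
theorem norm_embedding_sq_eq_abs_norm (x : K) :
    ‖w.1.embedding x‖ ^ 2 = (|(Algebra.norm ℚ x : ℚ)| : ℝ) := by
  haveI := subsingleton_infinitePlace_of_isComplex w h2
  have h := prod_eq_abs_norm x
  rw [Fintype.prod_subsingleton _ w.1, mult_isComplex w, ← norm_embedding_eq] at h
  rw [h, Rat.cast_abs]

omit [NumberField K] h2 in
/-- `|σ_w x|² > 0` for `x ≠ 0`. [cite: NeukirchANT1999, Ch. III §1 (1.3), product formula] -/
theorem norm_embedding_sq_pos {x : K} (hx : x ≠ 0) : 0 < ‖w.1.embedding x‖ ^ 2 := by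
  have : w.1.embedding x ≠ 0 := (map_ne_zero _).mpr hx
  positivity

/-- **For an imaginary quadratic field the representative set `pieceReps K ∅ 1 𝔞 a₀ N` is the whole punctured coset
`(a₀ + 𝔞) ∖ {0}`** (the cone-box condition over `Fin (rank K) = Fin 0` is void).
[cite: NeukirchANT1999, Ch. VII §8 proof of (8.3) (the system of representatives `ℜ`)] -/
theorem mem_pieceReps_iff_of_isComplex_of_finrank_eq_two {I : FractionalIdeal (𝓞 K)⁰ K} {a₀ : K} {N : ℕ} {x : K} :
    x ∈ pieceReps K ∅ 1 I a₀ N ↔ x - a₀ ∈ I ∧ x ≠ 0 := by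
  haveI : IsEmpty (Fin (rank K)) := by
    rw [units_rank_eq_zero_of_isComplex w h2]; infer_instance
  simp only [pieceReps, Set.mem_setOf_eq, signPiece_empty_one_iff, IsEmpty.forall_iff, and_true]

end ImagQuad

/-! ## §2. Bounds: the harmonic weight against the Gaussian; continuity; decay -/

/-- **Gaussian versus powers**: `u^m e^{-πδu²} ≤ e^{m²/(4πδ)}` for `u ≥ 0`, `δ > 0` (`(1 + u)^m ≤ e^{mu}` and completing the
square, via the tree's `exp_neg_mul_sq_le`). [cite: NeukirchANT1999, Ch. VII §3 (3.5) (proof steps)] -/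
theorem pow_mul_exp_neg_mul_sq_le (m : ℕ) {δ : ℝ} (hδ : 0 < δ) {u : ℝ} (hu : 0 ≤ u) :
    u ^ m * Real.exp (-(π * δ * u ^ 2)) ≤ Real.exp ((m : ℝ) ^ 2 / (4 * (π * δ))) := by
  have h := exp_neg_mul_sq_le (mul_pos Real.pi_pos hδ) (Nat.cast_nonneg m) hu
  have hu1 : 0 < 1 + u := by linarith
  have hpow : u ^ m ≤ (1 + u) ^ (m : ℝ) := by
    rw [Real.rpow_natCast]; exact pow_le_pow_left₀ hu (by linarith) m
  calc u ^ m * Real.exp (-(π * δ * u ^ 2))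
      ≤ (1 + u) ^ (m : ℝ) * (Real.exp ((m : ℝ) ^ 2 / (4 * (π * δ))) * (1 + u) ^ (-(m : ℝ))) := by
        rw [show -(π * δ * u ^ 2) = -(π * δ) * u ^ 2 by ring]
        exact mul_le_mul hpow h (Real.exp_pos _).le (by positivity)
    _ = Real.exp ((m : ℝ) ^ 2 / (4 * (π * δ))) := by
        rw [mul_left_comm, Real.rpow_neg hu1.le, mul_inv_cancel₀ (Real.rpow_pos_of_pos hu1 _).ne', mul_one]

section Bounds

variable (w : {w : InfinitePlace K // IsComplex w}) (h2 : Module.finrank ℚ K = 2)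
include h2

/-- **The weighted term against the Gaussian at half the parameter**: for `t ≥ δ > 0`,
`|σx|^m e^{-π⟨x·t𝟙,x⟩} ≤ e^{m²/(4πδ)} e^{-π⟨x·(t/2)𝟙,x⟩}` (split `e^{-2πt|σx|²} = e^{-πt|σx|²} · e^{-πt|σx|²}` and bound the
first factor with `pow_mul_exp_neg_mul_sq_le`). [cite: NeukirchANT1999, Ch. VII §3 (3.5) (proof steps)] -/
theorem norm_pow_mul_thetaSummand_le (m : ℕ) {δ : ℝ} (hδ : 0 < δ) {t : ℝ} (ht : δ ≤ t) (x : K) :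
    ‖w.1.embedding x‖ ^ m * thetaSummand K (fun _ ↦ t) x ≤
      Real.exp ((m : ℝ) ^ 2 / (4 * (π * δ))) * thetaSummand K (fun _ ↦ t / 2) x := by
  set u := ‖w.1.embedding x‖ with hu
  have hu0 : 0 ≤ u := norm_nonneg _
  rw [thetaSummand_const w h2, thetaSummand_const w h2]
  have hsplit : Real.exp (-(2 * π * t * u ^ 2)) = Real.exp (-(π * t * u ^ 2)) * Real.exp (-(π * t * u ^ 2)) := by
    rw [← Real.exp_add]; ring_nf
  have hhalf : Real.exp (-(2 * π * (t / 2) * u ^ 2)) = Real.exp (-(π * t * u ^ 2)) := by ring_nf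
  rw [hsplit, hhalf, ← mul_assoc]
  refine mul_le_mul_of_nonneg_right ?_ (Real.exp_pos _).le
  calc u ^ m * Real.exp (-(π * t * u ^ 2)) ≤ u ^ m * Real.exp (-(π * δ * u ^ 2)) := by
        refine mul_le_mul_of_nonneg_left (Real.exp_le_exp.mpr ?_) (pow_nonneg hu0 m)
        have : π * δ * u ^ 2 ≤ π * t * u ^ 2 := by gcongr
        linarith
    _ ≤ Real.exp ((m : ℝ) ^ 2 / (4 * (π * δ))) := pow_mul_exp_neg_mul_sq_le m hδ hu0

omit h2 in
/-- The norm of the general term `σ(x)^m e^{-π⟨x·t𝟙,x⟩}` of `Θ^{(m)}`. [cite: NeukirchANT1999, Ch. VII §3 (3.4)] -/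
theorem norm_heckeThetaC_term (m : ℕ) (t : ℝ) (x : K) :
    ‖w.1.embedding x ^ m * ((thetaSummand K (fun _ ↦ t) x : ℝ) : ℂ)‖ =
      ‖w.1.embedding x‖ ^ m * thetaSummand K (fun _ ↦ t) x := by
  rw [norm_mul, norm_pow, Complex.norm_real, Real.norm_of_nonneg (thetaSummand_pos _ x).le]

omit h2 in
/-- The norm of the general term `e^{2πi Tr(a₀b)} conj(σ b)^m e^{-π⟨b·t𝟙,b⟩}` of `Θ̂^{(m)}`.
[cite: NeukirchANT1999, Ch. VII §3 (3.4)] -/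
theorem norm_heckeThetaDualC_term (m : ℕ) (a₀ : K) (t : ℝ) (b : K) :
    ‖(𝐞 (((Algebra.trace ℚ K (a₀ * b) : ℚ) : ℝ)) : ℂ) * (conj (w.1.embedding b) ^ m *
        ((thetaSummand K (fun _ ↦ t) b : ℝ) : ℂ))‖ = ‖w.1.embedding b‖ ^ m * thetaSummand K (fun _ ↦ t) b := by
  rw [norm_mul, Circle.norm_coe, one_mul, norm_mul, norm_pow, Complex.norm_conj, Complex.norm_real,
    Real.norm_of_nonneg (thetaSummand_pos _ b).le]

/-- On `t ≥ δ` the terms of `Θ^{(m)}_{𝔞,a₀}(t𝟙)` are dominated by the summable family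
`e^{m²/(4πδ)} e^{-π⟨(a+a₀)(δ/2)𝟙, a+a₀⟩}`. [cite: NeukirchANT1999, Ch. VII §3 (3.5) Proposition] -/
theorem norm_heckeThetaC_term_le (m : ℕ) {δ : ℝ} (hδ : 0 < δ) {t : ℝ} (ht : δ ≤ t) (x : K) :
    ‖w.1.embedding x ^ m * ((thetaSummand K (fun _ ↦ t) x : ℝ) : ℂ)‖ ≤
      Real.exp ((m : ℝ) ^ 2 / (4 * (π * δ))) * thetaSummand K (fun _ ↦ δ / 2) x := by
  rw [norm_heckeThetaC_term w]
  refine (norm_pow_mul_thetaSummand_le w h2 m hδ ht x).trans (mul_le_mul_of_nonneg_left ?_ (Real.exp_pos _).le)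
  rw [thetaSummand_eq_mixedGaussian, thetaSummand_eq_mixedGaussian]
  exact mixedGaussian_le_mixedGaussian K (fun _ ↦ by linarith) _

omit h2 in
/-- The term `t ↦ σ(x)^m e^{-π⟨x·t𝟙,x⟩}` is continuous. [cite: NeukirchANT1999, Ch. VII §3 (3.5) (proof steps)] -/
theorem continuous_heckeThetaC_term (m : ℕ) (x : K) :
    Continuous fun t : ℝ ↦ w.1.embedding x ^ m * ((thetaSummand K (fun _ ↦ t) x : ℝ) : ℂ) :=
  continuous_const.mul (Complex.continuous_ofReal.comp
    ((continuous_thetaSummand x).comp (continuous_pi fun _ ↦ continuous_id)))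

/-- **`t ↦ Θ^{(m)}_{𝔞,a₀}(t𝟙)` is continuous on `[δ, ∞)`** for every `δ > 0` (uniform convergence, Neukirch VII (3.5)).
[cite: NeukirchANT1999, Ch. VII §3 (3.5) Proposition] -/
theorem continuousOn_heckeThetaC_const_of_le (m : ℕ) (I : FractionalIdeal (𝓞 K)⁰ K) (a₀ : K) {δ : ℝ} (hδ : 0 < δ) :
    ContinuousOn (fun t : ℝ ↦ heckeThetaC K w m I a₀ (fun _ ↦ t)) (Set.Ici δ) := by
  refine continuousOn_tsum (fun a ↦ (continuous_heckeThetaC_term w m ((a : K) + a₀)).continuousOn)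
    ((summable_thetaSummand_add I a₀ (fun _ ↦ half_pos hδ)).mul_left (Real.exp ((m : ℝ) ^ 2 / (4 * (π * δ)))))
    fun a t ht ↦ ?_
  exact norm_heckeThetaC_term_le w h2 m hδ ht _

/-- **`t ↦ Θ̂^{(m)}_{𝔟,a₀}(t𝟙)` is continuous on `[δ, ∞)`** for every `δ > 0`. [cite: NeukirchANT1999, Ch. VII §3 (3.5) Proposition] -/
theorem continuousOn_heckeThetaDualC_const_of_le (m : ℕ) (I : FractionalIdeal (𝓞 K)⁰ K) (a₀ : K) {δ : ℝ}
    (hδ : 0 < δ) : ContinuousOn (fun t : ℝ ↦ heckeThetaDualC K w m I a₀ (fun _ ↦ t)) (Set.Ici δ) := by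
  have h := summable_thetaSummand_add I 0 (fun _ ↦ half_pos hδ)
  simp only [add_zero] at h
  refine continuousOn_tsum (fun b ↦ ?_) (h.mul_left (Real.exp ((m : ℝ) ^ 2 / (4 * (π * δ))))) fun b t ht ↦ ?_
  · exact (continuous_const.mul (continuous_const.mul (Complex.continuous_ofReal.comp
      ((continuous_thetaSummand (b : K)).comp (continuous_pi fun _ ↦ continuous_id))))).continuousOn
  · rw [norm_heckeThetaDualC_term w, ← norm_heckeThetaC_term w]
    exact norm_heckeThetaC_term_le w h2 m hδ ht _

/-- `t ↦ Θ^{(m)}_{𝔞,a₀}(t𝟙)` is continuous on `(0, ∞)`. [cite: NeukirchANT1999, Ch. VII §3 (3.5) Proposition] -/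
theorem continuousOn_heckeThetaC_const (m : ℕ) (I : FractionalIdeal (𝓞 K)⁰ K) (a₀ : K) :
    ContinuousOn (fun t : ℝ ↦ heckeThetaC K w m I a₀ (fun _ ↦ t)) (Set.Ioi 0) := by
  intro t ht
  have ht2 : 0 < t / 2 := half_pos ht
  have hmem : Set.Ici (t / 2) ∈ 𝓝 t := Ici_mem_nhds (half_lt_self ht)
  exact ((continuousOn_heckeThetaC_const_of_le w h2 m I a₀ ht2).continuousAt hmem).continuousWithinAt

/-- `t ↦ Θ̂^{(m)}_{𝔟,a₀}(t𝟙)` is continuous on `(0, ∞)`. [cite: NeukirchANT1999, Ch. VII §3 (3.5) Proposition] -/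
theorem continuousOn_heckeThetaDualC_const (m : ℕ) (I : FractionalIdeal (𝓞 K)⁰ K) (a₀ : K) :
    ContinuousOn (fun t : ℝ ↦ heckeThetaDualC K w m I a₀ (fun _ ↦ t)) (Set.Ioi 0) := by
  intro t ht
  have ht2 : 0 < t / 2 := half_pos ht
  have hmem : Set.Ici (t / 2) ∈ 𝓝 t := Ici_mem_nhds (half_lt_self ht)
  exact ((continuousOn_heckeThetaDualC_const_of_le w h2 m I a₀ ht2).continuousAt hmem).continuousWithinAt

/-- **A priori bound for `m ≥ 1`**: `‖Θ^{(m)}_{𝔞,a₀}(t𝟙)‖ ≤ e^{m²/(4πδ)} · T_{𝔞,a₀}((t/2)𝟙)` for `t ≥ δ`, with the tree's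
absolute tail `T = weightedThetaTail K ∅` (`HeckeThetaBounds.lean`): for `m ≥ 1` the term at `a + a₀ = 0` vanishes, so
ALL terms are tail terms. [cite: NeukirchANT1999, Ch. VII §8 (8.4) Proposition (the estimate `f = a₀ + O(e^{-ct})`)] -/
theorem norm_heckeThetaC_const_le {m : ℕ} (hm : 1 ≤ m) (I : FractionalIdeal (𝓞 K)⁰ K) (a₀ : K) {δ : ℝ} (hδ : 0 < δ)
    {t : ℝ} (ht : δ ≤ t) :
    ‖heckeThetaC K w m I a₀ (fun _ ↦ t)‖ ≤
      Real.exp ((m : ℝ) ^ 2 / (4 * (π * δ))) * weightedThetaTail K ∅ I a₀ (fun _ ↦ t / 2) := by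
  set C := Real.exp ((m : ℝ) ^ 2 / (4 * (π * δ))) with hC
  have ht0 : 0 < t := hδ.trans_le ht
  set F : I → ℂ := fun a ↦ w.1.embedding ((a : K) + a₀) ^ m * ((thetaSummand K (fun _ ↦ t) ((a : K) + a₀) : ℝ) : ℂ)
    with hF
  set G : I → ℝ := fun a ↦ if (a : K) + a₀ = 0 then 0 else weightedThetaSummand K ∅ (fun _ ↦ t / 2) ((a : K) + a₀)
    with hG
  have hGs : Summable G := summable_weightedThetaTail ∅ I a₀ (fun _ ↦ half_pos ht0)
  have hle : ∀ a, ‖F a‖ ≤ C * G a := by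
    intro a
    simp only [hF, hG]
    split_ifs with h0
    · rw [h0, map_zero, zero_pow (by omega), zero_mul, norm_zero, mul_zero]
    · rw [weightedThetaSummand, Finset.prod_empty, one_mul, norm_heckeThetaC_term w]
      exact norm_pow_mul_thetaSummand_le w h2 m hδ ht _
  have hFs : Summable fun a ↦ ‖F a‖ :=
    Summable.of_nonneg_of_le (fun a ↦ norm_nonneg _) hle (hGs.mul_left C)
  calc ‖heckeThetaC K w m I a₀ (fun _ ↦ t)‖ = ‖∑' a, F a‖ := rfl
    _ ≤ ∑' a, ‖F a‖ := norm_tsum_le_tsum_norm hFs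
    _ ≤ ∑' a, C * G a := hFs.tsum_le_tsum hle (hGs.mul_left C)
    _ = C * weightedThetaTail K ∅ I a₀ (fun _ ↦ t / 2) := by rw [tsum_mul_left]; rfl

/-- **A priori bound for `m ≥ 1`, dual side**: `‖Θ̂^{(m)}_{𝔟,a₀}(t𝟙)‖ ≤ e^{m²/(4πδ)} · T_{𝔟,0}((t/2)𝟙)` for `t ≥ δ`.
[cite: NeukirchANT1999, Ch. VII §8 (8.4) Proposition (the estimate for `f_{F⁻¹}(𝔎',χ̄,t)`)] -/
theorem norm_heckeThetaDualC_const_le {m : ℕ} (hm : 1 ≤ m) (I : FractionalIdeal (𝓞 K)⁰ K) (a₀ : K) {δ : ℝ}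
    (hδ : 0 < δ) {t : ℝ} (ht : δ ≤ t) :
    ‖heckeThetaDualC K w m I a₀ (fun _ ↦ t)‖ ≤
      Real.exp ((m : ℝ) ^ 2 / (4 * (π * δ))) * weightedThetaTail K ∅ I 0 (fun _ ↦ t / 2) := by
  set C := Real.exp ((m : ℝ) ^ 2 / (4 * (π * δ))) with hC
  have ht0 : 0 < t := hδ.trans_le ht
  set F : I → ℂ := fun b ↦ (𝐞 (((Algebra.trace ℚ K (a₀ * (b : K)) : ℚ) : ℝ)) : ℂ) *
    (conj (w.1.embedding (b : K)) ^ m * ((thetaSummand K (fun _ ↦ t) (b : K) : ℝ) : ℂ)) with hF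
  set G : I → ℝ := fun b ↦ if (b : K) + 0 = 0 then 0 else weightedThetaSummand K ∅ (fun _ ↦ t / 2) ((b : K) + 0)
    with hG
  have hGs : Summable G := summable_weightedThetaTail ∅ I 0 (fun _ ↦ half_pos ht0)
  have hle : ∀ b, ‖F b‖ ≤ C * G b := by
    intro b
    simp only [hF, hG, add_zero]
    split_ifs with h0
    · rw [h0, map_zero, map_zero, zero_pow (by omega), zero_mul, mul_zero, norm_zero, mul_zero]
    · rw [weightedThetaSummand, Finset.prod_empty, one_mul, norm_heckeThetaDualC_term w]
      exact norm_pow_mul_thetaSummand_le w h2 m hδ ht _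
  have hFs : Summable fun b ↦ ‖F b‖ :=
    Summable.of_nonneg_of_le (fun b ↦ norm_nonneg _) hle (hGs.mul_left C)
  calc ‖heckeThetaDualC K w m I a₀ (fun _ ↦ t)‖ = ‖∑' b, F b‖ := rfl
    _ ≤ ∑' b, ‖F b‖ := norm_tsum_le_tsum_norm hFs
    _ ≤ ∑' b, C * G b := hFs.tsum_le_tsum hle (hGs.mul_left C)
    _ = C * weightedThetaTail K ∅ I 0 (fun _ ↦ t / 2) := by rw [tsum_mul_left]; rfl

/-- **Decay at `∞`**: for `m ≥ 1`, `𝔞 ≠ 0` and `2k > [K:ℚ]` there is `C` with `‖Θ^{(m)}_{𝔞,a₀}(t𝟙)‖ ≤ C t^{-k}` for `t ≥ 1`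
(Neukirch VII (8.4), `f_F(𝔎,χ,t) = O(e^{-ct^{1/n}})`, here with constant term `0`).
[cite: NeukirchANT1999, Ch. VII §8 (8.4) Proposition] -/
theorem norm_heckeThetaC_const_le_rpow {m : ℕ} (hm : 1 ≤ m) (I : FractionalIdeal (𝓞 K)⁰ K) (hI : I ≠ 0) (a₀ : K)
    {k : ℕ} (hk : Module.finrank ℚ K < 2 * k) :
    ∃ C : ℝ, ∀ t : ℝ, 1 ≤ t → ‖heckeThetaC K w m I a₀ (fun _ ↦ t)‖ ≤ C * t ^ (-(k : ℝ)) := by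
  obtain ⟨C, hC⟩ := exists_weightedThetaTail_le ∅ I hI a₀ hk
  refine ⟨Real.exp ((m : ℝ) ^ 2 / (4 * (π * 1))) * (C * 2 ^ k), fun t ht ↦ ?_⟩
  have ht0 : 0 < t := one_pos.trans_le ht
  have h1 := norm_heckeThetaC_const_le w h2 hm I a₀ one_pos ht
  have h2' := hC (t / 2) (half_pos ht0) (fun _ ↦ t / 2) fun _ ↦ le_rfl
  have hpow : (t / 2)⁻¹ ^ k = 2 ^ k * t ^ (-(k : ℝ)) := by
    rw [Real.rpow_neg ht0.le, Real.rpow_natCast, inv_div, div_pow, div_eq_mul_inv, ← inv_pow]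
  calc ‖heckeThetaC K w m I a₀ (fun _ ↦ t)‖
      ≤ Real.exp ((m : ℝ) ^ 2 / (4 * (π * 1))) * weightedThetaTail K ∅ I a₀ (fun _ ↦ t / 2) := h1
    _ ≤ Real.exp ((m : ℝ) ^ 2 / (4 * (π * 1))) * (C * (t / 2)⁻¹ ^ k) :=
        mul_le_mul_of_nonneg_left h2' (Real.exp_pos _).le
    _ = Real.exp ((m : ℝ) ^ 2 / (4 * (π * 1))) * (C * 2 ^ k) * t ^ (-(k : ℝ)) := by rw [hpow]; ring

/-- **Decay at `∞`, dual side**: for `m ≥ 1`, `𝔟 ≠ 0`, `2k > [K:ℚ]` there is `C` with `‖Θ̂^{(m)}_{𝔟,a₀}(t𝟙)‖ ≤ C t^{-k}` for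
`t ≥ 1`. [cite: NeukirchANT1999, Ch. VII §8 (8.4) Proposition] -/
theorem norm_heckeThetaDualC_const_le_rpow {m : ℕ} (hm : 1 ≤ m) (I : FractionalIdeal (𝓞 K)⁰ K) (hI : I ≠ 0) (a₀ : K)
    {k : ℕ} (hk : Module.finrank ℚ K < 2 * k) :
    ∃ C : ℝ, ∀ t : ℝ, 1 ≤ t → ‖heckeThetaDualC K w m I a₀ (fun _ ↦ t)‖ ≤ C * t ^ (-(k : ℝ)) := by
  obtain ⟨C, hC⟩ := exists_weightedThetaTail_le ∅ I hI 0 hk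
  refine ⟨Real.exp ((m : ℝ) ^ 2 / (4 * (π * 1))) * (C * 2 ^ k), fun t ht ↦ ?_⟩
  have ht0 : 0 < t := one_pos.trans_le ht
  have h1 := norm_heckeThetaDualC_const_le w h2 hm I a₀ one_pos ht
  have h2' := hC (t / 2) (half_pos ht0) (fun _ ↦ t / 2) fun _ ↦ le_rfl
  have hpow : (t / 2)⁻¹ ^ k = 2 ^ k * t ^ (-(k : ℝ)) := by
    rw [Real.rpow_neg ht0.le, Real.rpow_natCast, inv_div, div_pow, div_eq_mul_inv, ← inv_pow]
  calc ‖heckeThetaDualC K w m I a₀ (fun _ ↦ t)‖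
      ≤ Real.exp ((m : ℝ) ^ 2 / (4 * (π * 1))) * weightedThetaTail K ∅ I 0 (fun _ ↦ t / 2) := h1
    _ ≤ Real.exp ((m : ℝ) ^ 2 / (4 * (π * 1))) * (C * (t / 2)⁻¹ ^ k) :=
        mul_le_mul_of_nonneg_left h2' (Real.exp_pos _).le
    _ = Real.exp ((m : ℝ) ^ 2 / (4 * (π * 1))) * (C * 2 ^ k) * t ^ (-(k : ℝ)) := by rw [hpow]; ring

omit h2 in
/-- From `‖h(t)‖ ≤ C t^{-k}` (`t ≥ 1`) for all large `k` to `h = O(t^r)` at `∞` for every real `r`.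
[cite: NeukirchANT1999, Ch. VII §1 (1.4) (hypotheses of the Mellin principle)] -/
theorem isBigO_atTop_of_forall_le_rpow_neg {h : ℝ → ℂ}
    (H : ∀ k : ℕ, Module.finrank ℚ K < 2 * k → ∃ C : ℝ, ∀ t : ℝ, 1 ≤ t → ‖h t‖ ≤ C * t ^ (-(k : ℝ))) (r : ℝ) :
    (fun t ↦ h t - 0) =O[atTop] fun t ↦ t ^ r := by
  obtain ⟨k, hk, hkr⟩ : ∃ k : ℕ, Module.finrank ℚ K < 2 * k ∧ -(k : ℝ) ≤ r := by
    obtain ⟨k, hk⟩ := exists_nat_gt (max (Module.finrank ℚ K : ℝ) (-r))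
    refine ⟨k, ?_, ?_⟩
    · have : (Module.finrank ℚ K : ℝ) < k := (le_max_left _ _).trans_lt hk
      exact_mod_cast (show (Module.finrank ℚ K : ℝ) < 2 * k by linarith)
    · have : -r < k := (le_max_right _ _).trans_lt hk
      linarith
  obtain ⟨C, hC⟩ := H k hk
  refine Asymptotics.IsBigO.of_bound |C| ?_
  filter_upwards [Filter.eventually_ge_atTop (1 : ℝ)] with t ht
  have ht0 : 0 < t := one_pos.trans_le ht
  rw [sub_zero, Real.norm_of_nonneg (Real.rpow_nonneg ht0.le r)]
  calc ‖h t‖ ≤ C * t ^ (-(k : ℝ)) := hC t ht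
    _ ≤ |C| * t ^ (-(k : ℝ)) := mul_le_mul_of_nonneg_right (le_abs_self C) (Real.rpow_nonneg ht0.le _)
    _ ≤ |C| * t ^ r := mul_le_mul_of_nonneg_left (Real.rpow_le_rpow_of_exponent_le ht hkr) (abs_nonneg C)

end Bounds

/-! ## §3. The strong FE-pair of weight `m + 1` -/

section Pair

variable (w : {w : InfinitePlace K // IsComplex w}) (h2 : Module.finrank ℚ K = 2)
include h2

/-- **`Θ^{(m)}_{𝔞,a₀}(t⁻¹𝟙) = (-i)^m (𝔑(𝔞)√|d_K|)⁻¹ t^{m+1} Θ̂^{(m)}_{(𝔞𝔡)⁻¹,a₀}(t𝟙)`** for `t > 0` — the transformation formula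
`heckeThetaC_eq_heckeThetaDualC` on the diagonal of an imaginary quadratic field (`N(t⁻¹𝟙)^{1/2} = t⁻¹`): the first formula of
Neukirch VII (8.4), `f_F(𝔎,χ,1/t) = W t^{1/2+Tr(p)/n} f_{F⁻¹}(𝔎',χ̄,t)` with `n = 2`, `Tr(p) = 2m`… in our normalisation the
weight is `m + 1`. [cite: NeukirchANT1999, Ch. VII §8 (8.4) Proposition] -/
theorem heckeThetaC_const_inv (m : ℕ) (I : (FractionalIdeal (𝓞 K)⁰ K)ˣ) (a₀ : K) {t : ℝ} (ht : 0 < t) :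
    heckeThetaC K w m I a₀ (fun _ ↦ t⁻¹) = (-Complex.I) ^ m *
      ((((FractionalIdeal.absNorm (I : FractionalIdeal (𝓞 K)⁰ K) : ℝ) * Real.sqrt |(discr K : ℝ)|)⁻¹ : ℝ) : ℂ) *
      (t : ℂ) ^ (m + 1) * heckeThetaDualC K w m (FractionalIdeal.dual ℤ ℚ (I : FractionalIdeal (𝓞 K)⁰ K)) a₀ (fun _ ↦ t) := by
  have hinv : ∀ v : InfinitePlace K, 0 < (fun _ : InfinitePlace K ↦ t⁻¹) v := fun _ ↦ inv_pos.mpr ht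
  rw [heckeThetaC_eq_heckeThetaDualC w m I a₀ hinv, mixedNorm_const w h2, Real.sqrt_sq (inv_pos.mpr ht).le]
  simp only [inv_inv]
  have ht' : (t : ℂ) ≠ 0 := by exact_mod_cast ht.ne'
  have hN : (((FractionalIdeal.absNorm (I : FractionalIdeal (𝓞 K)⁰ K) : ℝ) * Real.sqrt |(discr K : ℝ)| : ℝ) : ℂ) ≠ 0 := by
    exact_mod_cast absNorm_mul_sqrt_discr_ne_zero _ I.ne_zero
  push_cast
  simp only [mul_inv, inv_pow, inv_inv]
  ring

variable (K) in
/-- **The FE-pair of Hecke's theta function with harmonic weight `m ≥ 1` over an imaginary quadratic field** (Neukirch VII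
(8.3)–(8.4) ⇒ hypotheses of the Mellin principle (1.4), here Mathlib's `WeakFEPair`, in fact STRONG: `f₀ = g₀ = 0`):
`f(t) = Θ^{(m)}_{𝔞,a₀}(t𝟙)`, `g(t) = Θ̂^{(m)}_{(𝔞𝔡)⁻¹,a₀}(t𝟙)`, weight `k = m + 1`, constant `ε = (-i)^m (𝔑(𝔞)√|d_K|)⁻¹`.
Consequently `Λ(s) = ∫₀^∞ f(t) t^{s} dt/t` is ENTIRE and `Λ(m+1-s) = ε Λ̂(s)` (Mathlib `IsStrongFEPair.differentiable_Λ`,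
`WeakFEPair.functional_equation`). [cite: NeukirchANT1999, Ch. VII §8 (8.3)–(8.5)] -/
def heckeThetaPairC {m : ℕ} (hm : 1 ≤ m) (I : (FractionalIdeal (𝓞 K)⁰ K)ˣ) (a₀ : K) : WeakFEPair ℂ where
  f := fun t ↦ heckeThetaC K w m I a₀ (fun _ ↦ t)
  g := fun t ↦ heckeThetaDualC K w m (FractionalIdeal.dual ℤ ℚ (I : FractionalIdeal (𝓞 K)⁰ K)) a₀ (fun _ ↦ t)
  k := m + 1
  ε := (-Complex.I) ^ m *
    ((((FractionalIdeal.absNorm (I : FractionalIdeal (𝓞 K)⁰ K) : ℝ) * Real.sqrt |(discr K : ℝ)|)⁻¹ : ℝ) : ℂ)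
  f₀ := 0
  g₀ := 0
  hf_int := (continuousOn_heckeThetaC_const w h2 m I a₀).locallyIntegrableOn measurableSet_Ioi
  hg_int := (continuousOn_heckeThetaDualC_const w h2 m _ a₀).locallyIntegrableOn measurableSet_Ioi
  hk := by positivity
  hε := mul_ne_zero (pow_ne_zero _ (neg_ne_zero.mpr Complex.I_ne_zero))
    (by exact_mod_cast inv_ne_zero (absNorm_mul_sqrt_discr_ne_zero _ I.ne_zero))
  h_feq := fun x hx ↦ by
    have hx0 : 0 < x := hx
    simp only [one_div]
    have : ((x ^ ((m : ℝ) + 1) : ℝ) : ℂ) = (x : ℂ) ^ (m + 1) := by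
      rw [show ((m : ℝ) + 1) = ((m + 1 : ℕ) : ℝ) by push_cast; ring, Real.rpow_natCast]
      push_cast; ring
    rw [heckeThetaC_const_inv w h2 m I a₀ hx0, smul_eq_mul, this]
  hf_top := fun r ↦ isBigO_atTop_of_forall_le_rpow_neg
    (fun _ hk ↦ norm_heckeThetaC_const_le_rpow w h2 hm I I.ne_zero a₀ hk) r
  hg_top := fun r ↦ isBigO_atTop_of_forall_le_rpow_neg
    (fun _ hk ↦ norm_heckeThetaDualC_const_le_rpow w h2 hm _ (FractionalIdeal.dual_ne_zero ℤ ℚ I.ne_zero) a₀ hk) r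

/-- The FE-pair is strong (`f₀ = g₀ = 0`). [cite: NeukirchANT1999, Ch. VII §8 (8.5) Theorem ("holomorphic on all of `ℂ` if `p ≠ 0`")] -/
theorem isStrongFEPair_heckeThetaPairC {m : ℕ} (hm : 1 ≤ m) (I : (FractionalIdeal (𝓞 K)⁰ K)ˣ) (a₀ : K) :
    IsStrongFEPair (heckeThetaPairC K w h2 hm I a₀) :=
  ⟨rfl, rfl⟩

/-- Unfolding: the `f` of the pair. [cite: NeukirchANT1999, Ch. VII §8 (8.3)] -/
@[simp] theorem heckeThetaPairC_f {m : ℕ} (hm : 1 ≤ m) (I : (FractionalIdeal (𝓞 K)⁰ K)ˣ) (a₀ : K) (t : ℝ) :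
    (heckeThetaPairC K w h2 hm I a₀).f t = heckeThetaC K w m I a₀ (fun _ ↦ t) := rfl

/-- Unfolding: the `g` of the pair. [cite: NeukirchANT1999, Ch. VII §8 (8.4)] -/
@[simp] theorem heckeThetaPairC_g {m : ℕ} (hm : 1 ≤ m) (I : (FractionalIdeal (𝓞 K)⁰ K)ˣ) (a₀ : K) (t : ℝ) :
    (heckeThetaPairC K w h2 hm I a₀).g t =
      heckeThetaDualC K w m (FractionalIdeal.dual ℤ ℚ (I : FractionalIdeal (𝓞 K)⁰ K)) a₀ (fun _ ↦ t) := rfl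

/-- Unfolding: the weight is `m + 1`. [cite: NeukirchANT1999, Ch. VII §8 (8.4)] -/
@[simp] theorem heckeThetaPairC_k {m : ℕ} (hm : 1 ≤ m) (I : (FractionalIdeal (𝓞 K)⁰ K)ˣ) (a₀ : K) :
    (heckeThetaPairC K w h2 hm I a₀).k = m + 1 := rfl

/-- Unfolding: the constant `ε = (-i)^m (𝔑(𝔞)√|d_K|)⁻¹`. [cite: NeukirchANT1999, Ch. VII §8 (8.4)] -/
theorem heckeThetaPairC_ε {m : ℕ} (hm : 1 ≤ m) (I : (FractionalIdeal (𝓞 K)⁰ K)ˣ) (a₀ : K) :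
    (heckeThetaPairC K w h2 hm I a₀).ε = (-Complex.I) ^ m *
      ((((FractionalIdeal.absNorm (I : FractionalIdeal (𝓞 K)⁰ K) : ℝ) * Real.sqrt |(discr K : ℝ)|)⁻¹ : ℝ) : ℂ) := rfl

/-- **`Λ` is entire.** [cite: NeukirchANT1999, Ch. VII §8 (8.5) Theorem] -/
theorem differentiable_heckeThetaPairC_Λ {m : ℕ} (hm : 1 ≤ m) (I : (FractionalIdeal (𝓞 K)⁰ K)ˣ) (a₀ : K) :
    Differentiable ℂ (heckeThetaPairC K w h2 hm I a₀).Λ :=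
  (isStrongFEPair_heckeThetaPairC w h2 hm I a₀).differentiable_Λ

/-- **`Λ̂` is entire.** [cite: NeukirchANT1999, Ch. VII §8 (8.5) Theorem] -/
theorem differentiable_heckeThetaPairC_symm_Λ {m : ℕ} (hm : 1 ≤ m) (I : (FractionalIdeal (𝓞 K)⁰ K)ˣ) (a₀ : K) :
    Differentiable ℂ (heckeThetaPairC K w h2 hm I a₀).symm.Λ :=
  (isStrongFEPair_heckeThetaPairC w h2 hm I a₀).symm.differentiable_Λ

/-- **The functional equation `Λ(m + 1 - s) = ε Λ̂(s)`.** [cite: NeukirchANT1999, Ch. VII §8 (8.5) Theorem] -/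
theorem heckeThetaPairC_Λ_sub {m : ℕ} (hm : 1 ≤ m) (I : (FractionalIdeal (𝓞 K)⁰ K)ˣ) (a₀ : K) (s : ℂ) :
    (heckeThetaPairC K w h2 hm I a₀).Λ ((m : ℂ) + 1 - s) =
      (heckeThetaPairC K w h2 hm I a₀).ε * (heckeThetaPairC K w h2 hm I a₀).symm.Λ s := by
  have h := (heckeThetaPairC K w h2 hm I a₀).functional_equation s
  rw [heckeThetaPairC_k, smul_eq_mul] at h
  exact_mod_cast h

end Pair

/-! ## §4. The unfolded Mellin transforms -/

section Mellin

variable (w : {w : InfinitePlace K // IsComplex w}) (h2 : Module.finrank ℚ K = 2)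
include w h2

/-- **Sums over the coset `a₀ + 𝔞` are sums over the representatives** `pieceReps K ∅ 1 𝔞 a₀ N = (a₀ + 𝔞) ∖ {0}` (imaginary
quadratic `K`), for any function vanishing at `0` (re-indexing `a ↦ a + a₀`, dropping the vanishing term).
[cite: NeukirchANT1999, Ch. VII §8 proof of (8.3) (the system of representatives `ℜ`)] -/
theorem tsum_coset_eq_tsum_pieceReps {E : Type*} [AddCommMonoid E] [TopologicalSpace E]
    (I : FractionalIdeal (𝓞 K)⁰ K) (a₀ : K) (N : ℕ) (φ : K → E) (hφ : φ 0 = 0) :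
    ∑' a : I, φ ((a : K) + a₀) = ∑' x : pieceReps K ∅ 1 I a₀ N, φ x := by
  have hmem : ∀ x : pieceReps K ∅ 1 I a₀ N, (x : K) - a₀ ∈ I := fun x ↦
    ((mem_pieceReps_iff_of_isComplex_of_finrank_eq_two w h2).mp x.2).1
  let i : pieceReps K ∅ 1 I a₀ N → I := fun x ↦ ⟨(x : K) - a₀, hmem x⟩
  have hi : ∀ x, ((i x : I) : K) = (x : K) - a₀ := fun x ↦ rfl
  have hinj : Function.Injective i := by
    intro x y hxy
    have h := congrArg (fun z : I ↦ (z : K)) hxy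
    simp only [hi] at h
    exact Subtype.ext (sub_left_injective h)
  have hsupp : Function.support (fun a : I ↦ φ ((a : K) + a₀)) ⊆ Set.range i := by
    intro a ha
    rw [Function.mem_support] at ha
    have hx0 : (a : K) + a₀ ≠ 0 := fun h ↦ ha (by rw [h, hφ])
    have hxmem : (a : K) + a₀ ∈ pieceReps K ∅ 1 I a₀ N :=
      (mem_pieceReps_iff_of_isComplex_of_finrank_eq_two w h2).mpr ⟨by simp, hx0⟩
    exact ⟨⟨(a : K) + a₀, hxmem⟩, Subtype.ext (by rw [hi]; simp)⟩
  rw [← hinj.tsum_eq hsupp]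
  exact tsum_congr fun x ↦ by simp only [hi, sub_add_cancel]

/-- Summability over the coset versus over the representatives (same re-indexing).
[cite: NeukirchANT1999, Ch. VII §8 proof of (8.3) (the system of representatives `ℜ`)] -/
theorem summable_coset_iff_summable_pieceReps {E : Type*} [AddCommMonoid E] [TopologicalSpace E]
    (I : FractionalIdeal (𝓞 K)⁰ K) (a₀ : K) (N : ℕ) (φ : K → E) (hφ : φ 0 = 0) :
    Summable (fun a : I ↦ φ ((a : K) + a₀)) ↔ Summable (fun x : pieceReps K ∅ 1 I a₀ N ↦ φ x) := by
  have hmem : ∀ x : pieceReps K ∅ 1 I a₀ N, (x : K) - a₀ ∈ I := fun x ↦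
    ((mem_pieceReps_iff_of_isComplex_of_finrank_eq_two w h2).mp x.2).1
  let i : pieceReps K ∅ 1 I a₀ N → I := fun x ↦ ⟨(x : K) - a₀, hmem x⟩
  have hi : ∀ x, ((i x : I) : K) = (x : K) - a₀ := fun x ↦ rfl
  have hinj : Function.Injective i := by
    intro x y hxy
    have h := congrArg (fun z : I ↦ (z : K)) hxy
    simp only [hi] at h
    exact Subtype.ext (sub_left_injective h)
  have hzero : ∀ a : I, a ∉ Set.range i → φ ((a : K) + a₀) = 0 := by
    intro a ha
    by_contra hne
    have hx0 : (a : K) + a₀ ≠ 0 := fun h ↦ hne (by rw [h, hφ])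
    have hxmem : (a : K) + a₀ ∈ pieceReps K ∅ 1 I a₀ N :=
      (mem_pieceReps_iff_of_isComplex_of_finrank_eq_two w h2).mpr ⟨by simp, hx0⟩
    exact ha ⟨⟨(a : K) + a₀, hxmem⟩, Subtype.ext (by rw [hi]; simp)⟩
  rw [← hinj.summable_iff hzero]
  exact summable_congr fun x ↦ by simp only [Function.comp_apply, hi, sub_add_cancel]

/-- The general term `t^{s-1} · c · e^{-π⟨x·t𝟙,x⟩}` as a `Γ`-integrand: for `x ≠ 0`,
`c e^{-π⟨x·t𝟙,x⟩} = c e^{-(2π|σx|²) t}`. [cite: NeukirchANT1999, Ch. VII §8 proof of (8.3) (the `Γ`-integral)] -/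
theorem cpow_mul_const_mul_thetaSummand_eq (s : ℂ) (c : ℂ) (x : K) (t : ℝ) :
    (t : ℂ) ^ (s - 1) * (c * ((thetaSummand K (fun _ ↦ t) x : ℝ) : ℂ)) =
      c * ((t : ℂ) ^ (s - 1) * Complex.exp (-(((2 * π * ‖w.1.embedding x‖ ^ 2 : ℝ) : ℂ) * (t : ℂ)))) := by
  rw [thetaSummand_const w h2, show 2 * π * t * ‖w.1.embedding x‖ ^ 2 = (2 * π * ‖w.1.embedding x‖ ^ 2) * t by ring,
    Complex.ofReal_exp, Complex.ofReal_neg, Complex.ofReal_mul]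
  ring

/-- `(1/(2π|σx|²))^s = (2π)^{-s} |N_{K/ℚ}(x)|^{-s}` (complex powers of positive reals).
[cite: NeukirchANT1999, Ch. VII §8 proof of (8.3) (the `Γ`-integral)] -/
theorem one_div_cpow_eq {x : K} (hx : x ≠ 0) (s : ℂ) :
    (1 / (((2 * π * ‖w.1.embedding x‖ ^ 2 : ℝ) : ℂ))) ^ s =
      (2 * Real.pi : ℂ) ^ (-s) * ((|(Algebra.norm ℚ x : ℚ)| : ℝ) : ℂ) ^ (-s) := by
  have hu := norm_embedding_sq_pos w hx
  have hr : 0 < 2 * π * ‖w.1.embedding x‖ ^ 2 := by positivity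
  have harg : (((2 * π * ‖w.1.embedding x‖ ^ 2 : ℝ) : ℂ)).arg ≠ π := by
    rw [Complex.arg_ofReal_of_nonneg hr.le]; exact Real.pi_ne_zero.symm
  rw [one_div, Complex.inv_cpow _ _ harg, ← Complex.cpow_neg, ← norm_embedding_sq_eq_abs_norm w h2,
    show ((2 * π * ‖w.1.embedding x‖ ^ 2 : ℝ) : ℂ) = ((2 * π : ℝ) : ℂ) * ((‖w.1.embedding x‖ ^ 2 : ℝ) : ℂ) by
      push_cast; ring,
    Complex.mul_cpow_ofReal_nonneg (by positivity) hu.le]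
  push_cast
  ring

/-- **The termwise `Γ`-integral**: for `x ≠ 0` and `re s > 0`,
`∫₀^∞ t^{s-1} c e^{-π⟨x·t𝟙,x⟩} dt = c (2π)^{-s} |N_{K/ℚ}(x)|^{-s} Γ(s)` (Neukirch VII (8.3): the substitution
`y ↦ π|a|²y` in the `Γ`-integral). [cite: NeukirchANT1999, Ch. VII §8 proof of (8.3)] -/
theorem integral_cpow_mul_const_mul_thetaSummand {s : ℂ} (hs : 0 < s.re) (c : ℂ) {x : K} (hx : x ≠ 0) :
    ∫ t in Set.Ioi (0 : ℝ), (t : ℂ) ^ (s - 1) * (c * ((thetaSummand K (fun _ ↦ t) x : ℝ) : ℂ)) =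
      c * ((2 * Real.pi : ℂ) ^ (-s) * ((|(Algebra.norm ℚ x : ℚ)| : ℝ) : ℂ) ^ (-s) * Complex.Gamma s) := by
  have hr : 0 < 2 * π * ‖w.1.embedding x‖ ^ 2 := by have := norm_embedding_sq_pos w hx; positivity
  simp_rw [cpow_mul_const_mul_thetaSummand_eq w h2 s c x]
  rw [integral_const_mul, integral_cpow_mul_exp_neg_mul_Ioi hs hr, one_div_cpow_eq w h2 hx]

/-- The norm of the general term on `t > 0`: `‖t^{s-1} c e^{-π⟨x·t𝟙,x⟩}‖ = ‖c‖ t^{re s - 1} e^{-(2π|σx|²)t}`.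
[cite: NeukirchANT1999, Ch. VII §8 proof of (8.3) (absolute convergence)] -/
theorem norm_cpow_mul_const_mul_thetaSummand (s : ℂ) (c : ℂ) (x : K) {t : ℝ} (ht : 0 < t) :
    ‖(t : ℂ) ^ (s - 1) * (c * ((thetaSummand K (fun _ ↦ t) x : ℝ) : ℂ))‖ =
      ‖c‖ * (t ^ (s.re - 1) * Real.exp (-((2 * π * ‖w.1.embedding x‖ ^ 2) * t))) := by
  rw [norm_mul, Complex.norm_cpow_eq_rpow_re_of_pos ht, Complex.sub_re, Complex.one_re, norm_mul, Complex.norm_real,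
    Real.norm_of_nonneg (thetaSummand_pos _ x).le, thetaSummand_const w h2,
    show 2 * π * t * ‖w.1.embedding x‖ ^ 2 = (2 * π * ‖w.1.embedding x‖ ^ 2) * t by ring]
  ring

/-- **Integrability of the general term** on `(0, ∞)` for `x ≠ 0`, `re s > 0` (comparison with `t^{re s-1} e^{-rt}`).
[cite: NeukirchANT1999, Ch. VII §8 proof of (8.3) (absolute convergence)] -/
theorem integrableOn_cpow_mul_const_mul_thetaSummand {s : ℂ} (hs : 0 < s.re) (c : ℂ) {x : K} (hx : x ≠ 0) :
    IntegrableOn (fun t : ℝ ↦ (t : ℂ) ^ (s - 1) * (c * ((thetaSummand K (fun _ ↦ t) x : ℝ) : ℂ))) (Set.Ioi 0) := by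
  have hr : 0 < 2 * π * ‖w.1.embedding x‖ ^ 2 := by have := norm_embedding_sq_pos w hx; positivity
  have hg : IntegrableOn (fun t : ℝ ↦ ‖c‖ * (t ^ (s.re - 1) * Real.exp (-((2 * π * ‖w.1.embedding x‖ ^ 2) * t))))
      (Set.Ioi 0) := by
    have h : IntegrableOn (fun t : ℝ ↦ ‖c‖ * (t ^ (s.re - 1) * Real.exp (-(2 * π * ‖w.1.embedding x‖ ^ 2) * t ^ (1 : ℝ))))
        (Set.Ioi 0) :=
      (integrableOn_rpow_mul_exp_neg_mul_rpow (s := s.re - 1) (p := 1) (by linarith) le_rfl hr).const_mul ‖c‖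
    refine IntegrableOn.congr_fun h (fun t _ ↦ ?_) measurableSet_Ioi
    simp only [Real.rpow_one, neg_mul]
  refine hg.mono' ?_ ?_
  · refine ContinuousOn.aestronglyMeasurable (fun t ht ↦ ?_) measurableSet_Ioi
    exact ((Complex.continuousAt_ofReal_cpow_const t (s - 1) (Or.inr (ne_of_gt ht))).mul
      ((continuous_const.mul (Complex.continuous_ofReal.comp ((continuous_thetaSummand x).comp
        (continuous_pi fun _ ↦ continuous_id)))).continuousAt)).continuousWithinAt
  · refine (ae_restrict_iff' measurableSet_Ioi).mpr (Filter.Eventually.of_forall fun t ht ↦ ?_)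
    rw [norm_cpow_mul_const_mul_thetaSummand w h2 s c x ht]

/-- **The integral of the norm of the general term**: for `x ≠ 0`, `re s > 0`,
`∫₀^∞ ‖t^{s-1} c e^{-π⟨x·t𝟙,x⟩}‖ dt = ‖c‖ (2π)^{-re s} |N(x)|^{-re s} Γ(re s)`.
[cite: NeukirchANT1999, Ch. VII §8 proof of (8.3) (absolute convergence)] -/
theorem integral_norm_cpow_mul_const_mul_thetaSummand {s : ℂ} (hs : 0 < s.re) (c : ℂ) {x : K} (hx : x ≠ 0) :
    ∫ t in Set.Ioi (0 : ℝ), ‖(t : ℂ) ^ (s - 1) * (c * ((thetaSummand K (fun _ ↦ t) x : ℝ) : ℂ))‖ =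
      ‖c‖ * ((2 * π) ^ (-s.re) * (|(Algebra.norm ℚ x : ℚ)| : ℝ) ^ (-s.re) * Real.Gamma s.re) := by
  have hu := norm_embedding_sq_pos w hx
  have hr : 0 < 2 * π * ‖w.1.embedding x‖ ^ 2 := by positivity
  rw [setIntegral_congr_fun measurableSet_Ioi (fun t ht ↦ norm_cpow_mul_const_mul_thetaSummand w h2 s c x ht),
    integral_const_mul]
  have h := Real.integral_rpow_mul_exp_neg_mul_Ioi hs hr
  rw [h, one_div, Real.inv_rpow hr.le, ← Real.rpow_neg hr.le, Real.mul_rpow (by positivity) hu.le,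
    norm_embedding_sq_eq_abs_norm w h2]

/-- **Summability of the norm integrals** over the representatives for `re s > m/2 + 1`: the series
`Σ_{x ∈ ℜ} |σx|^m (2π)^{-σ} |N(x)|^{-σ} Γ(σ) = Γ(σ)(2π)^{-σ} Σ |N(x)|^{-(σ - m/2)}` converges (`summable_pieceReps_norm_rpow`).
[cite: NeukirchANT1999, Ch. VII §8 (8.1) Proposition (absolute convergence for `re s > 1` after unitary normalisation)] -/
theorem summable_pieceReps_integral_norm (m : ℕ) (I : FractionalIdeal (𝓞 K)⁰ K) (a₀ : K) (N : ℕ) {s : ℂ}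
    (hs : (m : ℝ) / 2 + 1 < s.re) (c : K → ℂ) (hc : ∀ x, ‖c x‖ = ‖w.1.embedding x‖ ^ m) :
    Summable fun x : pieceReps K ∅ 1 I a₀ N ↦
      ∫ t in Set.Ioi (0 : ℝ), ‖(t : ℂ) ^ (s - 1) * (c x * ((thetaSummand K (fun _ ↦ t) x : ℝ) : ℂ))‖ := by
  have hs0 : 0 < s.re := by
    have : (0 : ℝ) ≤ (m : ℝ) / 2 := by positivity
    linarith
  have hσ : 1 < s.re - (m : ℝ) / 2 := by linarith
  have hsum := (summable_pieceReps_norm_rpow ∅ 1 I a₀ N hσ).mul_left ((2 * π) ^ (-s.re) * Real.Gamma s.re)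
  refine hsum.congr fun x ↦ ?_
  have hx : (x : K) ≠ 0 := ne_zero_of_mem_pieceReps x.2
  have hNpos : 0 < (|(Algebra.norm ℚ (x : K) : ℚ)| : ℝ) := by
    rw [← norm_embedding_sq_eq_abs_norm w h2]; exact norm_embedding_sq_pos w hx
  rw [integral_norm_cpow_mul_const_mul_thetaSummand w h2 hs0 (c x) hx, hc]
  -- `|σx|^m = |N(x)|^{m/2}`
  have hpow : ‖w.1.embedding (x : K)‖ ^ m = (|(Algebra.norm ℚ (x : K) : ℚ)| : ℝ) ^ ((m : ℝ) / 2) := by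
    rw [← norm_embedding_sq_eq_abs_norm w h2, ← Real.rpow_natCast _ 2, ← Real.rpow_mul (norm_nonneg _),
      ← Real.rpow_natCast]
    congr 1
    push_cast
    ring
  rw [hpow, show -(s.re - (m : ℝ) / 2) = (m : ℝ) / 2 + -s.re by ring, Real.rpow_add hNpos]
  ring

variable {w}

/-- **Unfolding the Mellin transform of `f`** (Neukirch VII (8.3), "`Λ(𝔎,χ,s) = L(f,s)`", for the coset `a₀ + 𝔞` and the
harmonic weight `σ^m` over an imaginary quadratic field): for `re s > m/2 + 1` and every `N`,
`Λ(s) = (2π)^{-s} Γ(s) Σ_{x ∈ (a₀+𝔞)∖0} σ(x)^m |N_{K/ℚ}(x)|^{-s}`, the sum indexed by `pieceReps K ∅ 1 𝔞 a₀ N`.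
[cite: NeukirchANT1999, Ch. VII §8 (8.3) Proposition] -/
theorem heckeThetaPairC_Λ_eq {m : ℕ} (hm : 1 ≤ m) (I : (FractionalIdeal (𝓞 K)⁰ K)ˣ) (a₀ : K) (N : ℕ) {s : ℂ}
    (hs : (m : ℝ) / 2 + 1 < s.re) :
    (heckeThetaPairC K w h2 hm I a₀).Λ s = (2 * Real.pi : ℂ) ^ (-s) * Complex.Gamma s *
      ∑' x : pieceReps K ∅ 1 (I : FractionalIdeal (𝓞 K)⁰ K) a₀ N,
        w.1.embedding (x : K) ^ m * ((|(Algebra.norm ℚ (x : K) : ℚ)| : ℝ) : ℂ) ^ (-s) := by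
  have hs0 : 0 < s.re := by
    have : (0 : ℝ) ≤ (m : ℝ) / 2 := by positivity
    linarith
  set R := pieceReps K ∅ 1 (I : FractionalIdeal (𝓞 K)⁰ K) a₀ N with hR
  haveI : Countable R := countable_pieceReps ∅ 1 _ a₀ N
  -- the terms
  set T : R → ℝ → ℂ := fun x t ↦ (t : ℂ) ^ (s - 1) *
    (w.1.embedding (x : K) ^ m * ((thetaSummand K (fun _ ↦ t) (x : K) : ℝ) : ℂ)) with hT
  -- Step 1: `Λ(s) = ∫₀^∞ t^{s-1} f(t)` and `t^{s-1} f(t) = Σ_x T x t`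
  have hΛ : (heckeThetaPairC K w h2 hm I a₀).Λ s =
      ∫ t in Set.Ioi (0 : ℝ), ∑' x : R, T x t := by
    rw [← ((isStrongFEPair_heckeThetaPairC w h2 hm I a₀).hasMellin s).2, mellin]
    refine setIntegral_congr_fun measurableSet_Ioi fun t _ ↦ ?_
    rw [heckeThetaPairC_f, smul_eq_mul, heckeThetaC, ← tsum_mul_left]
    exact tsum_coset_eq_tsum_pieceReps w h2 (I : FractionalIdeal (𝓞 K)⁰ K) a₀ N
      (fun x ↦ (t : ℂ) ^ (s - 1) * (w.1.embedding x ^ m * ((thetaSummand K (fun _ ↦ t) x : ℝ) : ℂ)))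
      (by rw [map_zero, zero_pow (by omega), zero_mul, mul_zero])
  -- Step 2: interchange
  have hint : ∀ x : R, Integrable (T x) (volume.restrict (Set.Ioi 0)) := fun x ↦
    integrableOn_cpow_mul_const_mul_thetaSummand w h2 hs0 _ (ne_zero_of_mem_pieceReps x.2)
  have hsum : Summable fun x : R ↦ ∫ t in Set.Ioi (0 : ℝ), ‖T x t‖ :=
    summable_pieceReps_integral_norm w h2 m _ a₀ N hs (fun x ↦ w.1.embedding x ^ m) (fun x ↦ by rw [norm_pow])
  rw [hΛ, ← integral_tsum_of_summable_integral_norm hint hsum]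
  -- Step 3: termwise `Γ`-integrals
  have hterm : ∀ x : R, ∫ t in Set.Ioi (0 : ℝ), T x t =
      w.1.embedding (x : K) ^ m * ((2 * Real.pi : ℂ) ^ (-s) * ((|(Algebra.norm ℚ (x : K) : ℚ)| : ℝ) : ℂ) ^ (-s) *
        Complex.Gamma s) := fun x ↦
    integral_cpow_mul_const_mul_thetaSummand w h2 hs0 _ (ne_zero_of_mem_pieceReps x.2)
  rw [tsum_congr hterm, ← tsum_mul_left]
  exact tsum_congr fun x ↦ by ring

/-- **Unfolding the Mellin transform of `g`** (the dual side of Neukirch VII (8.4)): for `re s > m/2 + 1` and every `N`,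
`Λ̂(s) = (2π)^{-s} Γ(s) Σ_{b ∈ (𝔞𝔡)⁻¹∖0} e^{2πi Tr(a₀b)} conj(σ b)^m |N_{K/ℚ}(b)|^{-s}`, the sum indexed by
`pieceReps K ∅ 1 (𝔞𝔡)⁻¹ 0 N`. [cite: NeukirchANT1999, Ch. VII §8 (8.4) Proposition] -/
theorem heckeThetaPairC_symm_Λ_eq {m : ℕ} (hm : 1 ≤ m) (I : (FractionalIdeal (𝓞 K)⁰ K)ˣ) (a₀ : K) (N : ℕ) {s : ℂ}
    (hs : (m : ℝ) / 2 + 1 < s.re) :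
    (heckeThetaPairC K w h2 hm I a₀).symm.Λ s = (2 * Real.pi : ℂ) ^ (-s) * Complex.Gamma s *
      ∑' b : pieceReps K ∅ 1 (FractionalIdeal.dual ℤ ℚ (I : FractionalIdeal (𝓞 K)⁰ K)) 0 N,
        (𝐞 (((Algebra.trace ℚ K (a₀ * (b : K)) : ℚ) : ℝ)) : ℂ) * conj (w.1.embedding (b : K)) ^ m *
          ((|(Algebra.norm ℚ (b : K) : ℚ)| : ℝ) : ℂ) ^ (-s) := by
  have hs0 : 0 < s.re := by
    have : (0 : ℝ) ≤ (m : ℝ) / 2 := by positivity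
    linarith
  set J := FractionalIdeal.dual ℤ ℚ (I : FractionalIdeal (𝓞 K)⁰ K) with hJ
  set R := pieceReps K ∅ 1 J 0 N with hR
  haveI : Countable R := countable_pieceReps ∅ 1 _ 0 N
  set c : K → ℂ := fun b ↦ (𝐞 (((Algebra.trace ℚ K (a₀ * b) : ℚ) : ℝ)) : ℂ) * conj (w.1.embedding b) ^ m with hc
  have hc0 : ∀ b, ‖c b‖ = ‖w.1.embedding b‖ ^ m := fun b ↦ by
    rw [hc]; simp only [norm_mul, Circle.norm_coe, one_mul, norm_pow, Complex.norm_conj]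
  set T : R → ℝ → ℂ := fun b t ↦ (t : ℂ) ^ (s - 1) * (c b * ((thetaSummand K (fun _ ↦ t) (b : K) : ℝ) : ℂ)) with hT
  have hΛ : (heckeThetaPairC K w h2 hm I a₀).symm.Λ s = ∫ t in Set.Ioi (0 : ℝ), ∑' b : R, T b t := by
    rw [← ((isStrongFEPair_heckeThetaPairC w h2 hm I a₀).symm.hasMellin s).2, mellin]
    refine setIntegral_congr_fun measurableSet_Ioi fun t _ ↦ ?_
    have hsymm : (heckeThetaPairC K w h2 hm I a₀).symm.f t = heckeThetaDualC K w m J a₀ (fun _ ↦ t) := rfl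
    rw [hsymm, smul_eq_mul, heckeThetaDualC, ← tsum_mul_left]
    have h := tsum_coset_eq_tsum_pieceReps w h2 J 0 N
      (fun b ↦ (t : ℂ) ^ (s - 1) * (c b * ((thetaSummand K (fun _ ↦ t) b : ℝ) : ℂ)))
      (by rw [hc]; simp only [map_zero, zero_pow (Nat.one_le_iff_ne_zero.mp hm), mul_zero, zero_mul])
    simp only [add_zero] at h
    rw [← h]
    exact tsum_congr fun b ↦ by rw [hc]; ring
  have hint : ∀ b : R, Integrable (T b) (volume.restrict (Set.Ioi 0)) := fun b ↦
    integrableOn_cpow_mul_const_mul_thetaSummand w h2 hs0 _ (ne_zero_of_mem_pieceReps b.2)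
  have hsum : Summable fun b : R ↦ ∫ t in Set.Ioi (0 : ℝ), ‖T b t‖ :=
    summable_pieceReps_integral_norm w h2 m J 0 N hs c hc0
  rw [hΛ, ← integral_tsum_of_summable_integral_norm hint hsum]
  have hterm : ∀ b : R, ∫ t in Set.Ioi (0 : ℝ), T b t =
      c b * ((2 * Real.pi : ℂ) ^ (-s) * ((|(Algebra.norm ℚ (b : K) : ℚ)| : ℝ) : ℂ) ^ (-s) * Complex.Gamma s) := fun b ↦
    integral_cpow_mul_const_mul_thetaSummand w h2 hs0 _ (ne_zero_of_mem_pieceReps b.2)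
  rw [tsum_congr hterm, ← tsum_mul_left]
  exact tsum_congr fun b ↦ by rw [hc]; ring

end Mellin

end NumberField

end Literature.NumberTheory.LFunctions

end
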